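import Summits.NavierStokesRegularity.NavierStokesRegularity.Theorems.L3TimeExponentPincerRegularPointUniformBound
import HarnessLib.Audit
import HarnessLib

/-!
# L3TimeExponentPincer — singular limit points from blowing-up a.e.-representatives

Support kernel for the crux `L3CascadeJaw` (item stmt-NavierStokesRegularity-19499) of route
`L3TimeExponentPincer`; a variant of
`…Theorems.L3TimeExponentPincerRegularPointUniformBound.not_isRegularPoint_of_unbounded` for the
(J) reduction of planner nsreg-p2's ROUND-12 §2b (blueprint attached to the item).  There the
compactness fact (`jia_sverak_leray_weak_stability_holds`) is applied to local Leray solutions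
`u^k ∈ 𝒩(w₀^k)` which coincide only ALMOST EVERYWHERE (weak–strong uniqueness
`leray_solution_ae_eq_kato_holds`) with the smooth normalised solutions `w^k` carrying the
information `‖w^k(1, 0)‖ > k`; continuity of the `u^k` themselves is not available.

* `not_isRegularPoint_of_unbounded_ae` — in `RusinSverak2011.CompactnessSituation O u^k p^k u p`,
  if on open sets `V_k` one has `u^k = w^k` a.e. with `w^k` continuous on `V_k`, and
  `‖w^k(z_k)‖ → ∞` along points `z_k ∈ V_k`, `z_k → z₀ ∈ O`, then `z₀` is a singular point of `u`.

WHAT THIS IS NOT: not NS regularity or blow-up; bookkeeping over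
`uniform_bound_near_regularPoint`; the crux `L3CascadeJaw` is untouched; no crux claim.
-/

noncomputable section

open MeasureTheory Set Function Filter Topology TopologicalSpace Metric
open scoped NNReal ENNReal

namespace Summit.NavierStokesRegularity.NavierStokesRegularity.Theorems.L3TimeExponentPincerRegularPointUniformBoundAE

open Literature.Analysis.FluidPDE
open Summit.NavierStokesRegularity.NavierStokesRegularity.Theorems.L3TimeExponentPincerRegularPointUniformBound

/-- **Singular limit points from blowing-up a.e.-representatives.**  In the situation of
Rusin–Šverák's Prop. 2.2 on `O`, suppose that on open sets `V_k` the approximants `u^k` agree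
a.e. with fields `w^k` continuous on `V_k`, and that `‖w^k(z_k)‖ → ∞` along points `z_k ∈ V_k`
converging to `z₀ ∈ O`.  Then `z₀` is not a regular point of the limit `u`. -/
theorem not_isRegularPoint_of_unbounded_ae
    {O : Opens (ℝ × (EuclideanSpace ℝ (Fin 3)))}
    {useq : ℕ → ℝ → (EuclideanSpace ℝ (Fin 3)) → (EuclideanSpace ℝ (Fin 3))}
    {pseq : ℕ → ℝ → (EuclideanSpace ℝ (Fin 3)) → ℝ}
    {u : ℝ → (EuclideanSpace ℝ (Fin 3)) → (EuclideanSpace ℝ (Fin 3))} {p : ℝ → (EuclideanSpace ℝ (Fin 3)) → ℝ}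
    (hsit : RusinSverak2011.CompactnessSituation O useq pseq u p)
    {wseq : ℕ → ℝ → (EuclideanSpace ℝ (Fin 3)) → (EuclideanSpace ℝ (Fin 3))}
    {V : ℕ → Set (ℝ × (EuclideanSpace ℝ (Fin 3)))} (hV : ∀ k, IsOpen (V k))
    (hae : ∀ k, ∀ᵐ w ∂(volume.restrict (V k)), useq k w.1 w.2 = wseq k w.1 w.2)
    (hcont : ∀ k, ContinuousOn (uncurry (wseq k)) (V k))
    {z : ℕ → ℝ × (EuclideanSpace ℝ (Fin 3))} {z₀ : ℝ × (EuclideanSpace ℝ (Fin 3))} (hz₀ : z₀ ∈ O)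
    (hzV : ∀ k, z k ∈ V k) (hz : Tendsto z atTop (𝓝 z₀))
    (hblow : Tendsto (fun k => ‖wseq k (z k).1 (z k).2‖) atTop atTop) :
    ¬ IsRegularPoint u z₀ := by
  intro hreg
  obtain ⟨ρ, hρ, B, hB⟩ := uniform_bound_near_regularPoint hsit hz₀ hreg
  have hevz : ∀ᶠ k in atTop, z k ∈ parabolicCylinderCentered ρ z₀ :=
    hz.eventually_mem ((isOpen_parabolicCylinderCentered ρ z₀).mem_nhds
      (self_mem_parabolicCylinderCentered hρ z₀))
  have hbig : ∀ᶠ k in atTop, B + 1 ≤ ‖wseq k (z k).1 (z k).2‖ := hblow.eventually_ge_atTop (B + 1)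
  obtain ⟨k, ⟨hkB, hkz⟩, hkbig⟩ := ((hB.and hevz).and hbig).exists
  -- the open set `W = Q*_ρ(z₀) ∩ V_k ∋ z_k`
  set W : Set (ℝ × (EuclideanSpace ℝ (Fin 3))) := parabolicCylinderCentered ρ z₀ ∩ V k with hW
  have hWopen : IsOpen W := (isOpen_parabolicCylinderCentered ρ z₀).inter (hV k)
  have hmem : z k ∈ W := ⟨hkz, hzV k⟩
  have hcontk : ContinuousOn (fun w : ℝ × (EuclideanSpace ℝ (Fin 3)) => ‖wseq k w.1 w.2‖) W :=
    ((hcont k).mono inter_subset_right).norm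
  obtain ⟨U, hUopen, hzU, hU⟩ : ∃ U : Set (ℝ × (EuclideanSpace ℝ (Fin 3))), IsOpen U ∧ z k ∈ U ∧
      U ⊆ {w | w ∈ W ∧ B < ‖wseq k w.1 w.2‖} := by
    have hpre := hcontk.isOpen_inter_preimage hWopen (isOpen_Ioi (a := B))
    refine ⟨_, hpre, ⟨hmem, ?_⟩, fun w hw => ⟨hw.1, hw.2⟩⟩
    show B < ‖wseq k (z k).1 (z k).2‖
    linarith
  have hUpos : 0 < volume U := hUopen.measure_pos volume ⟨z k, hzU⟩
  have hUsubQ : U ⊆ parabolicCylinderCentered ρ z₀ := fun w hw => (hU hw).1.1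
  have hUsubV : U ⊆ V k := fun w hw => (hU hw).1.2
  -- a.e. on `U`: `‖u^k‖ ≤ B` and `u^k = w^k`, contradicting `‖w^k‖ > B` on `U`
  have h1 : ∀ᵐ w ∂(volume.restrict U), ‖useq k w.1 w.2‖ ≤ B :=
    ae_restrict_of_ae_restrict_of_subset hUsubQ hkB
  have h2 : ∀ᵐ w ∂(volume.restrict U), useq k w.1 w.2 = wseq k w.1 w.2 :=
    ae_restrict_of_ae_restrict_of_subset hUsubV (hae k)
  have hfalse : ∀ᵐ w ∂(volume.restrict U), False := by
    filter_upwards [h1, h2, ae_restrict_mem hUopen.measurableSet] with w hw hw' hwU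
    rw [hw'] at hw
    exact absurd hw (not_le.2 (hU hwU).2)
  rw [ae_iff] at hfalse
  simp only [not_false_eq_true, setOf_true, Measure.restrict_apply_univ] at hfalse
  exact hUpos.ne' hfalse

end Summit.NavierStokesRegularity.NavierStokesRegularity.Theorems.L3TimeExponentPincerRegularPointUniformBoundAE

end
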